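import Summits.BirchSwinnertonDyer.BirchSwinnertonDyer.Theses.PrintX9
import Summits.BirchSwinnertonDyer.BirchSwinnertonDyer.Theorems.PrintX9HowardContainmentLightFramePinnedOfPrintSharpOfMuCoherentPair
import Summits.BirchSwinnertonDyer.BirchSwinnertonDyer.Theorems.PrintX9HowardContainmentLightFrameOfPrintDepthPosLocalized
import Summits.BirchSwinnertonDyer.BirchSwinnertonDyer.Theorems.Rank1ResidualX9CMPartner
import Summits.BirchSwinnertonDyer.Rank1Residual.X9.LeafDischargeScalarImage
import HarnessLib

/-!
# Closers for plan g10's RESPLIT v2 family of `PrintX9.HowardContainmentLightFramePinnedOfPrintSharp` (stmt-27077, row 9; THE CUT v2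
# 12:02:33Z): the μ-free discharge support `PrintHypothesesDischargeX9` and the new glue
# `HowardContainmentLightFramePinnedOfPrintSharpOfCoherentPair := MuInequalityCoherentPair → PrintHypothesesDischargeX9 → 27077`

(FILE PREPARED BY THE PEN BEFORE THE RESPLIT LANDED — propose only once `Theses.PrintX9` declares `MuInequalityCoherentPair`,
`PrintHypothesesDischargeX9`, `HowardContainmentLightFramePinnedOfPrintSharpOfCoherentPair` (kit
`HOME/plan/turnkeys/g10-split/resplit/resplit9v2`): any PROVER seat (x9-p1 lineage first) runs
`ledger propose --kind proof --target Summits/BirchSwinnertonDyer/BirchSwinnertonDyer/Theorems/PrintX9ResplitClosersCoherentPair.lean --file <this>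
--workitem <X9 glue id>`, then `ledger workitem close <PrintHypothesesDischargeX9 id> --as proved --by
Summit.BirchSwinnertonDyer.BirchSwinnertonDyer.Theorems.PrintX9Resplit.printHypothesesDischargeX9_holds`. CERTIFIED 2026-08-28T13:2xZ by plan g11
against LOCAL copies of the three decls (texts = children4-x9.json / Sketch4.lean verbatim): g11 folder `kitcheck/X9ReadyScratch.lean`, rc 0 · 0 sorry.)

Cell `pub/bsd-print-x9`, pen `bsd-print-x9-plan` (g11); twin of x10b-p2 LEAD g4's `HOME/p2/PrintX10bResplitClosersCoherentPair-READY.lean`.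
THEOREMS ONLY; no sorry. `printHypothesesDischargeX9_holds`: every light X9 Heegner frame (ClassX9, odd `d_K ≠ -3`, (Heeg) for `N_E` and `p`,
irr_K, anticyclotomic `κ` with top generator `γ`) satisfies CGLS 2022 Thm 4.1.3's standing hypotheses
(`Rank1Residual.X9.thm413Hypotheses_of_lightFrame`), is non-CM with `E[p]` irreducible over ℚ (fields of `ClassX9`) and has p-adic scalar
image (`Rank1Residual.ClassX9.hasPadicScalarImage`, Lombardo–Tronto 2022 Thm 3.16 / MZ26 Ass. 2.13 (v)). The glue closes in ONE line over the
LANDED L∃ closer `PrintX9SharpMuCoherentPair.howardContainmentLightFramePinnedOfPrintSharp_of_muPartStabilizedCoherentPair` (p631843, x9-p1 LEAD g2;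
the route's `MuInequalityCoherentPair` is `Iff.rfl`-equal to `HeegnerMuPartStabilized.MuPartStabilizedCoherentPair`, p630902); the discharge binder is
idle there. The shared μ-item itself is BEYOND citable PRINT at (p) (REF-118; away from (p) it is print:
`HeegnerMuPartStabilizedOffP.muPartStabilizedCoherentPairOffP_of_thm652`, p633008).
No summit statement is proved by this file; BSD is not proved by any of this.
-/

set_option linter.dupNamespace false
set_option autoImplicit false

noncomputable section

open Summit.BirchSwinnertonDyer.BirchSwinnertonDyer.Theses.PrintX9
  (MuInequalityCoherentPair PrintHypothesesDischargeX9 HowardContainmentLightFramePinnedOfPrintSharpOfCoherentPair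
   HowardContainmentLightFramePinnedOfPrintSharp)

namespace Summit.BirchSwinnertonDyer.BirchSwinnertonDyer.Theorems.PrintX9Resplit

/-- **`PrintHypothesesDischargeX9` holds**: the X9 light frame discharges `Thm413Hypotheses`
(`Rank1Residual.X9.thm413Hypotheses_of_lightFrame`), ¬CM and irr_ℚ (fields of `ClassX9`) and the MZ26 scalar clause
(`Rank1Residual.ClassX9.hasPadicScalarImage`).
[cite: LombardoTronto2022, Thm. 3.16] [cite: MastellaZerman2026, Assumption 2.13 (v)]
[cite: CastellaGrossiLeeSkinner2022, Thm. 4.1.3 (hypotheses)] -/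
theorem printHypothesesDischargeX9_holds : PrintHypothesesDischargeX9 := by
  intro W _ _ p _ _ K _ _ hX9 hK hodd h3 hHN hHp hirr κ hκ γ hγ
  have hX9' := Summit.BirchSwinnertonDyer.BirchSwinnertonDyer.Rank1Residual.classX9_census_of_classX9 W p hX9
  exact ⟨Summit.BirchSwinnertonDyer.Rank1Residual.X9.thm413Hypotheses_of_lightFrame hX9' hK hodd h3 hHN hHp hκ hγ, hX9.1,
    hX9.2.2.2.2.1, Literature.NumberTheory.EllipticCurves.Rank1Residual.ClassX9.hasPadicScalarImage hX9'⟩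

/-- **The new X9 glue `MuInequalityCoherentPair → PrintHypothesesDischargeX9 → HowardContainmentLightFramePinnedOfPrintSharp` holds**,
in one line over the landed L∃ closer (p631843); the discharge hypothesis is not needed by that closer (it re-derives the print
hypotheses from the frame binders itself).
[cite: MastellaZerman2026, Cor. 4.6] [cite: CastellaGrossiLeeSkinner2022, Thm. 4.1.1, Rem. 4.1.4]
[cite: CastellaGrossiSkinner2025, Thm. 6.5.2] [cite: Howard2004HeegnerKolyvagin, Thm. 2.2.10] -/
theorem howardContainmentLightFramePinnedOfPrintSharpOfCoherentPair_holds :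
    HowardContainmentLightFramePinnedOfPrintSharpOfCoherentPair :=
  fun h _ => PrintX9SharpMuCoherentPair.howardContainmentLightFramePinnedOfPrintSharp_of_muPartStabilizedCoherentPair h

/-- Curried form: the parent crux 27077 from the shared μ-item alone. -/
theorem howardContainmentLightFramePinnedOfPrintSharp_of_muInequalityCoherentPair (h : MuInequalityCoherentPair) :
    HowardContainmentLightFramePinnedOfPrintSharp :=
  howardContainmentLightFramePinnedOfPrintSharpOfCoherentPair_holds h printHypothesesDischargeX9_holds

end Summit.BirchSwinnertonDyer.BirchSwinnertonDyer.Theorems.PrintX9Resplit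

end
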